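import Mathlib
import Summits.NavierStokesRegularity.NavierStokesRegularity.Theorems.TaoLadderRungThreeGappedFrontRobustTailStart
import HarnessLib

/-!
# `GappedFrontRobust`, the (step) clause: THE START ENERGY OF THE FRONT BLOCK from a ball start around a
  tame reference state (helper for item stmt-NavierStokesRegularity-22114 `GappedFrontRobustV2`, STEP (3)
  of the K_B₂ assembly)

HONEST FRAMING: elementary real-number bookkeeping (geometric sums against the weights of a v2 gap
certificate, Tao 2016 §6.2 Prop. 6.3 (viii) statement shape); nothing is asserted about any table or flow;
nothing here concerns the Navier–Stokes equations. `block_start_energy_le`: from a ball start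
`w k |S₀_{i,k} − z_{i,k}| ≤ r` around a tame state `|z_{i,k}| ≤ C_T (1 + q^{−k})` (`w ≥ 1`, `q = 1+ε₀ > 1`),
the start energy `∑ ½ S₀²` of any block of shells `kb+1, …, kb+Lb ≤ kt` (`kt ≥ 0`) is at most `E⋆ q^{−2kb}`
with `E⋆ ≥ ½ m (2C_T + r)² q^{2kt}/(q² − 1)` — uniformly in `kb`, which is what the selection of `kb` needs.
-/

noncomputable section

-- the sub-problem namespace `Summit.NavierStokesRegularity.NavierStokesRegularity` repeats the summit name by design (D-0017)
set_option linter.dupNamespace false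

namespace Summit.NavierStokesRegularity.NavierStokesRegularity.Theorems

open Set Literature.Analysis.FluidPDE Literature.Analysis.FluidPDE.TaoCascade

namespace GappedFrontRobust

variable {m : ℕ}

/-- **Start energy of the front block** (exact flow, `F₀ = ½ S₀²`): from a ball start around a tame state,
`∑_{j<Lb} ∑_i ½ S₀_{i,kb+1+j}² ≤ E⋆ q^{−2kb}` whenever the block `kb+1, …, kb+Lb` lies below `kt ≥ 0` and
`E⋆ ≥ ½ m (2C_T + r)² q^{2kt}/(q²−1)` (`q = 1+ε₀ > 1`; every block shell carries `|S₀| ≤ (2C_T + r) q^{kt} q^{−k}`,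
and the geometric series is summed by `geom_partial_sum_le`).
[cite: Tao2016AveragedNS, §6.2 Prop. 6.3 (viii) (transition states behind the front, statement shape)] -/
theorem block_start_energy_le {ε₀ r C_T Estar : ℝ} (hε : 0 < ε₀) (hr : 0 ≤ r) (hCT : 0 ≤ C_T)
    {w : ℤ → ℝ} {z S₀ : Fin m → ℤ → ℝ} (hw1 : ∀ k, 1 ≤ w k)
    (hz : ∀ (i : Fin m) (k : ℤ), |z i k| ≤ C_T * (1 + (1 + ε₀) ^ (-(k : ℝ))))
    (hball : ∀ i k, w k * |S₀ i k - z i k| ≤ r) {kb kt : ℤ} {Lb : ℕ} (hkt : 0 ≤ kt)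
    (hLb : kb + Lb ≤ kt)
    (hEstar : 1 / 2 * (m : ℝ) * (2 * C_T + r) ^ 2 * (1 + ε₀) ^ ((2 : ℝ) * kt) / ((1 + ε₀) ^ 2 - 1) ≤ Estar) :
    ∑ j ∈ Finset.range Lb, ∑ i, (1 / 2) * S₀ i (kb + 1 + j) ^ 2 ≤
      Estar * (1 + ε₀) ^ (-(2 : ℝ) * kb) := by
  have hq : 0 < 1 + ε₀ := by linarith
  have hq1 : 1 < 1 + ε₀ := by linarith
  set q : ℝ := 1 + ε₀ with hqdef
  have hw : ∀ k, 0 < w k := fun k => lt_of_lt_of_le one_pos (hw1 k)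
  set B : ℝ := 1 / 2 * (m : ℝ) * (2 * C_T + r) ^ 2 * q ^ ((2 : ℝ) * kt) with hB
  have hB0 : 0 ≤ B := by have := Real.rpow_pos_of_pos hq ((2 : ℝ) * kt); positivity
  -- amplitude of a block shell
  have hamp : ∀ (i : Fin m) (k : ℤ), k ≤ kt → |S₀ i k| ≤ (2 * C_T + r) * q ^ (kt : ℝ) * q ^ (-(k : ℝ)) := by
    intro i k hk
    have h1 : |S₀ i k| ≤ |z i k| + r / w k := by
      have hb := hball i k
      have hwk := hw k
      have h2 : |S₀ i k - z i k| ≤ r / w k := by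
        rw [le_div_iff₀ hwk]; linarith [mul_comm (w k) |S₀ i k - z i k|]
      have := abs_sub_abs_le_abs_sub (S₀ i k) (z i k)
      linarith
    have h2 : r / w k ≤ r := div_le_self hr (hw1 k)
    have h3 := hz i k
    have hkr : (k : ℝ) ≤ kt := by exact_mod_cast hk
    have h4 : (1 : ℝ) ≤ q ^ (kt : ℝ) * q ^ (-(k : ℝ)) := by
      rw [← Real.rpow_add hq]; exact Real.one_le_rpow hq1.le (by linarith)
    have h5 : q ^ (-(k : ℝ)) ≤ q ^ (kt : ℝ) * q ^ (-(k : ℝ)) := by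
      have : (1 : ℝ) ≤ q ^ (kt : ℝ) := Real.one_le_rpow hq1.le (by exact_mod_cast hkt)
      have h0 : 0 ≤ q ^ (-(k : ℝ)) := (Real.rpow_pos_of_pos hq _).le
      nlinarith
    calc |S₀ i k| ≤ C_T * (1 + q ^ (-(k : ℝ))) + r := by linarith
      _ = C_T + C_T * q ^ (-(k : ℝ)) + r := by ring
      _ ≤ C_T * (q ^ (kt : ℝ) * q ^ (-(k : ℝ))) + C_T * (q ^ (kt : ℝ) * q ^ (-(k : ℝ))) +
            r * (q ^ (kt : ℝ) * q ^ (-(k : ℝ))) := by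
          have := mul_le_mul_of_nonneg_left h4 hCT
          have := mul_le_mul_of_nonneg_left h5 hCT
          have := mul_le_mul_of_nonneg_left h4 hr
          linarith
      _ = (2 * C_T + r) * q ^ (kt : ℝ) * q ^ (-(k : ℝ)) := by ring
  -- energy of a block shell: ∑_i ½ S₀² ≤ B q^{-2k}
  set g : ℤ → ℝ := fun k => B * q ^ (-(2 : ℝ) * k) with hg
  have hshell : ∀ j : ℕ, j < Lb → ∑ i, (1 / 2) * S₀ i (kb + 1 + j) ^ 2 ≤ g (kb + 1 + j) := by
    intro j hj
    set k : ℤ := kb + 1 + j with hk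
    have hkkt : k ≤ kt := by rw [hk]; omega
    have hsq : ∀ i, (1 / 2) * S₀ i k ^ 2 ≤ 1 / 2 * ((2 * C_T + r) * q ^ (kt : ℝ) * q ^ (-(k : ℝ))) ^ 2 := by
      intro i
      have h1 := hamp i k hkkt
      have h0 : 0 ≤ (2 * C_T + r) * q ^ (kt : ℝ) * q ^ (-(k : ℝ)) := (abs_nonneg _).trans h1
      have h2 : S₀ i k ^ 2 ≤ ((2 * C_T + r) * q ^ (kt : ℝ) * q ^ (-(k : ℝ))) ^ 2 := by
        rw [← sq_abs]; exact pow_le_pow_left₀ (abs_nonneg _) h1 2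
      linarith
    have hpow : ((2 * C_T + r) * q ^ (kt : ℝ) * q ^ (-(k : ℝ))) ^ 2 =
        (2 * C_T + r) ^ 2 * q ^ ((2 : ℝ) * kt) * q ^ (-(2 : ℝ) * k) := by
      rw [mul_pow, mul_pow, ← Real.rpow_natCast (q ^ (kt : ℝ)), ← Real.rpow_natCast (q ^ (-(k : ℝ))),
        ← Real.rpow_mul hq.le, ← Real.rpow_mul hq.le]
      push_cast; ring_nf
    calc ∑ i, (1 / 2) * S₀ i k ^ 2 ≤ ∑ _i : Fin m, 1 / 2 * ((2 * C_T + r) * q ^ (kt : ℝ) * q ^ (-(k : ℝ))) ^ 2 :=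
          Finset.sum_le_sum fun i _ => hsq i
      _ = (m : ℝ) * (1 / 2 * ((2 * C_T + r) * q ^ (kt : ℝ) * q ^ (-(k : ℝ))) ^ 2) := by
          simp [Finset.sum_const, Finset.card_univ]
      _ = g k := by simp only [hg, hB]; rw [hpow]; ring
  -- geometric summation
  have hρ : q ^ (-(2 : ℝ)) < 1 := Real.rpow_lt_one_of_one_lt_of_neg hq1 (by norm_num)
  have hρ0 : 0 ≤ q ^ (-(2 : ℝ)) := (Real.rpow_pos_of_pos hq _).le
  have hg0 : ∀ j : ℕ, 0 ≤ g (kb + 1 + j) := fun j => mul_nonneg hB0 (Real.rpow_pos_of_pos hq _).le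
  have hgstep : ∀ j : ℕ, g (kb + 1 + j + 1) ≤ q ^ (-(2 : ℝ)) * g (kb + 1 + j) := by
    intro j
    simp only [hg]
    have : q ^ (-(2 : ℝ) * (((kb + 1 + j + 1 : ℤ)) : ℝ)) = q ^ (-(2 : ℝ)) * q ^ (-(2 : ℝ) * (((kb + 1 + j : ℤ)) : ℝ)) := by
      rw [← Real.rpow_add hq]; push_cast; ring_nf
    rw [this]; exact le_of_eq (by ring)
  have hsum := geom_partial_sum_le (K := kb + 1) hρ0 hρ hg0 hgstep Lb
  -- g (kb+1) / (1 - q^{-2}) = B q^{-2kb} / (q² - 1)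
  have hq2 : q ^ (-(2 : ℝ)) = (q ^ 2)⁻¹ := by
    rw [Real.rpow_neg hq.le, show (2 : ℝ) = ((2 : ℕ) : ℝ) by norm_num, Real.rpow_natCast]
  have hq21 : 0 < q ^ 2 - 1 := by nlinarith
  have hval : g (kb + 1) / (1 - q ^ (-(2 : ℝ))) = B / (q ^ 2 - 1) * q ^ (-(2 : ℝ) * kb) := by
    simp only [hg]
    have e1 : q ^ (-(2 : ℝ) * (((kb + 1 : ℤ)) : ℝ)) = q ^ (-(2 : ℝ) * kb) * (q ^ 2)⁻¹ := by
      rw [← hq2, ← Real.rpow_add hq]; push_cast; ring_nf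
    rw [e1, hq2]
    have hq2pos : 0 < q ^ 2 := by positivity
    field_simp
  calc ∑ j ∈ Finset.range Lb, ∑ i, (1 / 2) * S₀ i (kb + 1 + j) ^ 2
      ≤ ∑ j ∈ Finset.range Lb, g (kb + 1 + j) :=
        Finset.sum_le_sum fun j hj => hshell j (Finset.mem_range.mp hj)
    _ ≤ g (kb + 1) / (1 - q ^ (-(2 : ℝ))) := hsum
    _ = B / (q ^ 2 - 1) * q ^ (-(2 : ℝ) * kb) := hval
    _ ≤ Estar * q ^ (-(2 : ℝ) * kb) := by
        refine mul_le_mul_of_nonneg_right ?_ (Real.rpow_pos_of_pos hq _).le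
        simp only [hB]; exact hEstar

end GappedFrontRobust

end Summit.NavierStokesRegularity.NavierStokesRegularity.Theorems

end
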